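import Mathlib
import HarnessLib
import Literature.Analysis.FluidPDE.SuitableWeak
import Summits.NavierStokesRegularity.NavierStokesRegularity.Theorems.RellichScarApexLocalisationQuantumAccounting

/-!
# Sharp quantum accounting over the `√2`-grid of parabolic bands (line
# dissipation-quantum-tolerance, crux ApexLocalisation, stub `stub_quantumAccountingSharp`)

`stub_quantumAccountingSharp`, the sharp sequel of `stub_quantumAccounting` (pure measure theory
over the scaled dissipation `cknE`). Write `F z := ENNReal.ofReal (frobeniusNormSq (G z.1 z.2))`
(an arbitrary `ℝ≥0∞`-valued function) and
`B(ρ, x) := Q((−ρ²/4, x), ρ/2) = (−ρ²/2, −ρ²/4) × B_{ρ/2}(x)` for the parabolic band of scale `ρ` at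
`x`. Its time window has logarithmic length `log 2`, so for `d² = 2c²` the windows of the two
interleaved dyadic families of scales `c/2^n` and `d/2^n` (the `√2`-grid) are the distinct
consecutive intervals `(−c²/2^m, −c²/2^{m+1})`; quanta `∫_{B(ρ,x)} F ≥ e ρ` at all scales thus add
up to `2 e c + 2 e d` on the union of these pairwise disjoint bands (`quantumAccounting_twoGrid`).

(a) Quanta `e ρ` in all bands `B(ρ, 0)` force `E(Q((0,0),R)) ≥ (2 + 2√2) e` for every `R > 0`: the
families `B(R/2^n, 0)`, `B(√2 R/2^n, 0)` lie in `Q((0,0),R)` and pay `(2 + 2√2) e R`.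

(b) If moreover all bands `B(ρ, b)` of a companion `‖b‖ = s > 0` carry quanta `e ρ`, then
`E(Q((0,0),2s)) ≥ (3 + 5√2/2) e`: the mother families `B(2s/2^n, 0)`, `B(2√2 s/2^n, 0)` pay
`(4 + 4√2) e s`, the companion families `B(√2 s/2/2^n, b)`, `B(s/2^n, b)` pay `(√2 + 2) e s`, all
inside `Q((0,0),2s)`; a mother and a companion band either have different windows (disjoint) or the
same scale `ρ ≤ s` and then disjoint balls (`ρ/2 + ρ/2 ≤ s = dist 0 b`). Total `(6 + 5√2) e s`.

[folklore]
-/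

set_option linter.dupNamespace false

namespace Summit.NavierStokesRegularity.NavierStokesRegularity.Theorems.RellichScarApexLocalisation

open MeasureTheory Set Function Metric Filter Topology TopologicalSpace
open scoped ENNReal NNReal
open Literature.Analysis Literature.Analysis.FluidPDE

local notation "E³" => EuclideanSpace ℝ (Fin 3)

/-! ### Geometry of the `√2`-grid of bands `B(ρ, x) = Q((−ρ²/4, x), ρ/2)` -/

/-- **Scales a factor `≥ √2` apart: disjoint time windows.** If `2ρ'² ≤ ρ²`, the bands
`B(ρ, x) = (−ρ²/2, −ρ²/4) × B_{ρ/2}(x)` and `B(ρ', y)` are disjoint: `−ρ'²/2 ≥ −ρ²/4`. -/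
theorem disjoint_parabolicBand_of_two_mul_sq_le {ρ ρ' : ℝ} (h : 2 * ρ' ^ 2 ≤ ρ ^ 2) (x y : E³) :
    Disjoint (parabolicCylinder (ρ / 2) ((-(ρ ^ 2 / 4) : ℝ), x))
      (parabolicCylinder (ρ' / 2) ((-(ρ' ^ 2 / 4) : ℝ), y)) := by
  refine Set.disjoint_left.2 fun w hw hw' => ?_
  simp only [mem_parabolicCylinder] at hw hw'
  nlinarith [hw.1.2, hw'.1.1]

/-- **Bands with different windows of one grid are disjoint** (any centres): if `ρ² = C/2^m` and
`ρ'² = C/2^{m'}` with `m ≠ m'`, the squared scales differ by a factor `≥ 2`. -/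
theorem disjoint_parabolicBand_of_sq_eq {C ρ ρ' : ℝ} (hC : 0 ≤ C) {m m' : ℕ} (hm : m ≠ m')
    (hρ : ρ ^ 2 = C / 2 ^ m) (hρ' : ρ' ^ 2 = C / 2 ^ m') (x y : E³) :
    Disjoint (parabolicCylinder (ρ / 2) ((-(ρ ^ 2 / 4) : ℝ), x))
      (parabolicCylinder (ρ' / 2) ((-(ρ' ^ 2 / 4) : ℝ), y)) := by
  rcases lt_or_gt_of_ne hm with h | h
  · refine disjoint_parabolicBand_of_two_mul_sq_le ?_ x y
    rw [hρ, hρ']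
    exact two_mul_div_two_pow_le hC h
  · refine (disjoint_parabolicBand_of_two_mul_sq_le ?_ y x).symm
    rw [hρ, hρ']
    exact two_mul_div_two_pow_le hC h

/-- **Large bands inside the big cylinder.** If `ρ² ≤ 2R²` and `‖x‖ + ρ/2 ≤ R`, then
`B(ρ, x) ⊆ Q((0, 0), R) = (−R², 0) × B_R(0)`: the window `(−ρ²/2, −ρ²/4)` only needs `ρ² ≤ 2R²`. -/
theorem parabolicBand_subset_cylinder_of_sq_le {ρ R : ℝ} {x : E³} (hρR : ρ ^ 2 ≤ 2 * R ^ 2)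
    (hx : ‖x‖ + ρ / 2 ≤ R) :
    parabolicCylinder (ρ / 2) ((-(ρ ^ 2 / 4) : ℝ), x) ⊆
      parabolicCylinder R ((0 : ℝ), (0 : E³)) := by
  intro w hw
  simp only [mem_parabolicCylinder] at hw ⊢
  refine ⟨⟨by nlinarith [hw.1.1], by nlinarith [hw.1.2, sq_nonneg ρ]⟩, ?_⟩
  calc dist w.2 0 ≤ dist w.2 x + dist x 0 := dist_triangle _ _ _
    _ < R := by rw [dist_zero_right]; linarith [hw.2]

/-! ### Two interleaved dyadic families at one centre -/

/-- **The `√2`-grid at one centre.** If every band `B(ρ, x)`, `ρ > 0`, carries `∫ F ≥ e ρ`, then for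
`d² = 2c²` the bands `B(c/2^n, x)` and `B(d/2^n, x)`, `n : ℕ`, are pairwise disjoint (their windows
are the distinct intervals `(−c²/2^m, −c²/2^{m+1})`, `m = 2n+1` resp. `m = 2n`) and pay
`Σ_n e c/2^n + Σ_n e d/2^n = 2 e c + 2 e d`. -/
theorem quantumAccounting_twoGrid (G : ℝ → E³ → E³ →L[ℝ] E³) {e : ℝ} (c d : ℝ) (x : E³)
    (he : 0 ≤ e) (hc : 0 < c) (hd : 0 < d) (hcd : d ^ 2 = 2 * c ^ 2)
    (h : ∀ ρ : ℝ, 0 < ρ → ENNReal.ofReal (e * ρ) ≤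
      ∫⁻ z in parabolicCylinder (ρ / 2) ((-(ρ ^ 2 / 4) : ℝ), x),
        ENNReal.ofReal (frobeniusNormSq (G z.1 z.2))) :
    ENNReal.ofReal (2 * e * c + 2 * e * d) ≤
      ∫⁻ z in (⋃ n : ℕ, parabolicCylinder (c / 2 ^ n / 2) ((-((c / 2 ^ n) ^ 2 / 4) : ℝ), x)) ∪
          ⋃ n : ℕ, parabolicCylinder (d / 2 ^ n / 2) ((-((d / 2 ^ n) ^ 2 / 4) : ℝ), x),
        ENNReal.ofReal (frobeniusNormSq (G z.1 z.2)) := by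
  set F : ℝ × E³ → ℝ≥0∞ := fun z => ENNReal.ofReal (frobeniusNormSq (G z.1 z.2))
  set A : ℕ → Set (ℝ × E³) := fun n =>
    parabolicCylinder (c / 2 ^ n / 2) ((-((c / 2 ^ n) ^ 2 / 4) : ℝ), x)
  set B : ℕ → Set (ℝ × E³) := fun n =>
    parabolicCylinder (d / 2 ^ n / 2) ((-((d / 2 ^ n) ^ 2 / 4) : ℝ), x)
  have hAm : ∀ n, MeasurableSet (A n) := fun n => (isOpen_parabolicCylinder _ _).measurableSet
  have hBm : ∀ n, MeasurableSet (B n) := fun n => (isOpen_parabolicCylinder _ _).measurableSet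
  -- windows of `A n` resp. `B k` are the intervals `m = 2n+1` resp. `m = 2k` of the grid `2c²/2^m`
  have hAB : Disjoint (⋃ n, A n) (⋃ n, B n) := by
    refine disjoint_iUnion_left.2 fun n => disjoint_iUnion_right.2 fun k => ?_
    have hn : (c / 2 ^ n) ^ 2 = 2 * c ^ 2 / 2 ^ (2 * n + 1) := by
      field_simp
      ring
    have hk : (d / 2 ^ k) ^ 2 = 2 * c ^ 2 / 2 ^ (2 * k) := by
      rw [div_pow, hcd]
      ring
    exact disjoint_parabolicBand_of_sq_eq (by positivity) (by omega) hn hk x x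
  have h1 : ∑' n : ℕ, ENNReal.ofReal (e * (c / 2 ^ n)) ≤ ∫⁻ z in ⋃ n, A n, F z :=
    tsum_le_lintegral_iUnion_of_le hAm (fun n m hnm => disjoint_dyadicBand_of_ne hc x x hnm) F
      fun n => h _ (by positivity)
  have h2 : ∑' n : ℕ, ENNReal.ofReal (e * (d / 2 ^ n)) ≤ ∫⁻ z in ⋃ n, B n, F z :=
    tsum_le_lintegral_iUnion_of_le hBm (fun n m hnm => disjoint_dyadicBand_of_ne hd x x hnm) F
      fun n => h _ (by positivity)
  calc ENNReal.ofReal (2 * e * c + 2 * e * d)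
        = (∑' n : ℕ, ENNReal.ofReal (e * (c / 2 ^ n))) +
          ∑' n : ℕ, ENNReal.ofReal (e * (d / 2 ^ n)) := by
          rw [tsum_ofReal_mul_div_two_pow he hc.le, tsum_ofReal_mul_div_two_pow he hd.le,
            ENNReal.ofReal_add (by positivity) (by positivity)]
    _ ≤ (∫⁻ z in ⋃ n, A n, F z) + ∫⁻ z in ⋃ n, B n, F z := add_le_add h1 h2
    _ = ∫⁻ z in (⋃ n, A n) ∪ ⋃ n, B n, F z :=
          (lintegral_union (MeasurableSet.iUnion hBm) hAB).symm

/-! ### The two sharp accounting statements -/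

/-- **(a) Sharp mother accounting.** Quanta `e ρ` in all bands `B(ρ, 0)` force
`E(Q((0,0),R)) ≥ (2 + 2√2) e`: the families `B(R/2^n, 0)` and `B(√2 R/2^n, 0)` are pairwise disjoint
inside `Q((0,0),R)` (radii `≤ √2 R/2 ≤ R`, windows inside `(−R², 0)`) and pay `2 e R + 2√2 e R`. -/
theorem quantumAccounting_mother_sharp (G : ℝ → E³ → E³ →L[ℝ] E³) (e : ℝ) (he : 0 ≤ e)
    (h : ∀ ρ : ℝ, 0 < ρ → ENNReal.ofReal (e * ρ) ≤
      ∫⁻ z in parabolicCylinder (ρ / 2) ((-(ρ ^ 2 / 4) : ℝ), (0 : E³)),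
        ENNReal.ofReal (frobeniusNormSq (G z.1 z.2)))
    (R : ℝ) (hR : 0 < R) :
    ENNReal.ofReal ((2 + 2 * Real.sqrt 2) * e) ≤ cknE R ((0 : ℝ), (0 : E³)) G := by
  unfold cknE
  refine ofReal_le_inv_ofReal_mul hR ?_
  have h2sq : Real.sqrt 2 ^ 2 = 2 := Real.sq_sqrt (by norm_num)
  have h2le : Real.sqrt 2 ≤ 2 := (Real.sqrt_le_left (by norm_num)).2 (by norm_num)
  have hd : 0 < Real.sqrt 2 * R := by positivity
  calc ENNReal.ofReal ((2 + 2 * Real.sqrt 2) * e * R)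
        = ENNReal.ofReal (2 * e * R + 2 * e * (Real.sqrt 2 * R)) := by
          congr 1
          ring
    _ ≤ ∫⁻ z in (⋃ n : ℕ, parabolicCylinder (R / 2 ^ n / 2)
              ((-((R / 2 ^ n) ^ 2 / 4) : ℝ), (0 : E³))) ∪
            ⋃ n : ℕ, parabolicCylinder (Real.sqrt 2 * R / 2 ^ n / 2)
              ((-((Real.sqrt 2 * R / 2 ^ n) ^ 2 / 4) : ℝ), (0 : E³)),
          ENNReal.ofReal (frobeniusNormSq (G z.1 z.2)) :=
          quantumAccounting_twoGrid G R (Real.sqrt 2 * R) 0 he hR hd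
            (by linear_combination (R ^ 2) * h2sq) h
    _ ≤ ∫⁻ z in parabolicCylinder R ((0 : ℝ), (0 : E³)),
          ENNReal.ofReal (frobeniusNormSq (G z.1 z.2)) := by
          refine lintegral_mono_set (union_subset (iUnion_subset fun n => ?_)
            (iUnion_subset fun n => ?_))
          · -- `B(R/2^n, 0)`: scale `≤ R`
            have h1 : R / 2 ^ n ≤ R := div_le_self hR.le (one_le_pow₀ (by norm_num))
            exact parabolicBand_subset_cylinder (by positivity) h1 (by rw [norm_zero]; linarith)
          · -- `B(√2 R/2^n, 0)`: squared scale `≤ 2R²`, radius `≤ √2 R/2 ≤ R`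
            have h1 : Real.sqrt 2 * R / 2 ^ n ≤ Real.sqrt 2 * R :=
              div_le_self hd.le (one_le_pow₀ (by norm_num))
            have h3 : Real.sqrt 2 * R ≤ 2 * R := mul_le_mul_of_nonneg_right h2le hR.le
            refine parabolicBand_subset_cylinder_of_sq_le ?_ (by rw [norm_zero]; linarith)
            calc (Real.sqrt 2 * R / 2 ^ n) ^ 2 ≤ (Real.sqrt 2 * R) ^ 2 :=
                  pow_le_pow_left₀ (by positivity) h1 2
              _ = 2 * R ^ 2 := by linear_combination (R ^ 2) * h2sq

/-- **(b) Sharp mother + companion accounting.** Quanta `e ρ` in all bands `B(ρ, 0)` and `B(ρ, b)`,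
`‖b‖ = s > 0`, force `E(Q((0,0),2s)) ≥ (3 + 5√2/2) e`: the mother families `B(2s/2^n, 0)`,
`B(2√2 s/2^n, 0)` pay `(4 + 4√2) e s`, the companion families `B(√2 s/2/2^n, b)`, `B(s/2^n, b)` pay
`(√2 + 2) e s`; all lie in `Q((0,0),2s)`, and the mother union is disjoint from the companion union
(windows `8s²/2^m`: mothers `m = 2n+1, 2n`, companions `m = 2k+4, 2k+3`; equal windows only for
equal scales `ρ ≤ s`, whose balls `B_{ρ/2}(0)`, `B_{ρ/2}(b)` are disjoint).
Total `(6 + 5√2) e s`. -/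
theorem quantumAccounting_companion_sharp (G : ℝ → E³ → E³ →L[ℝ] E³) (e s : ℝ) (b : E³)
    (he : 0 ≤ e) (hs : 0 < s) (hb : ‖b‖ = s)
    (h0 : ∀ ρ : ℝ, 0 < ρ → ENNReal.ofReal (e * ρ) ≤
      ∫⁻ z in parabolicCylinder (ρ / 2) ((-(ρ ^ 2 / 4) : ℝ), (0 : E³)),
        ENNReal.ofReal (frobeniusNormSq (G z.1 z.2)))
    (hb' : ∀ ρ : ℝ, 0 < ρ → ENNReal.ofReal (e * ρ) ≤
      ∫⁻ z in parabolicCylinder (ρ / 2) ((-(ρ ^ 2 / 4) : ℝ), b),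
        ENNReal.ofReal (frobeniusNormSq (G z.1 z.2))) :
    ENNReal.ofReal ((3 + 5 / 2 * Real.sqrt 2) * e) ≤ cknE (2 * s) ((0 : ℝ), (0 : E³)) G := by
  unfold cknE
  have hc : 0 < 2 * s := by positivity
  have h2sq : Real.sqrt 2 ^ 2 = 2 := Real.sq_sqrt (by norm_num)
  have h2le : Real.sqrt 2 ≤ 2 := (Real.sqrt_le_left (by norm_num)).2 (by norm_num)
  have h22 : Real.sqrt 2 * s ≤ 2 * s := mul_le_mul_of_nonneg_right h2le hs.le
  refine ofReal_le_inv_ofReal_mul hc ?_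
  -- squared scales of the four families lie on the grid `8 s² / 2^m`
  have h8 : (0 : ℝ) ≤ 8 * s ^ 2 := by positivity
  have eMB : (2 * Real.sqrt 2 * s) ^ 2 = 8 * s ^ 2 := by linear_combination (4 * s ^ 2) * h2sq
  have eCA : (Real.sqrt 2 * s / 2) ^ 2 = s ^ 2 / 2 := by linear_combination (s ^ 2 / 4) * h2sq
  have sqMA : ∀ n : ℕ, (2 * s / 2 ^ n) ^ 2 = 8 * s ^ 2 / 2 ^ (2 * n + 1) := fun n => by
    field_simp
    ring
  have sqMB : ∀ n : ℕ, (2 * Real.sqrt 2 * s / 2 ^ n) ^ 2 = 8 * s ^ 2 / 2 ^ (2 * n) := fun n => by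
    rw [div_pow, eMB]
    ring
  have sqCA : ∀ k : ℕ, (Real.sqrt 2 * s / 2 / 2 ^ k) ^ 2 = 8 * s ^ 2 / 2 ^ (2 * k + 4) :=
    fun k => by
    rw [div_pow, eCA]
    field_simp
    ring
  have sqCB : ∀ k : ℕ, (s / 2 ^ k) ^ 2 = 8 * s ^ 2 / 2 ^ (2 * k + 3) := fun k => by
    field_simp
    ring
  -- the integrand, the mother families `MA, MB` (centre `0`), the companion families `CA, CB`
  set F : ℝ × E³ → ℝ≥0∞ := fun z => ENNReal.ofReal (frobeniusNormSq (G z.1 z.2))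
  set MA : ℕ → Set (ℝ × E³) := fun n =>
    parabolicCylinder (2 * s / 2 ^ n / 2) ((-((2 * s / 2 ^ n) ^ 2 / 4) : ℝ), (0 : E³))
  set MB : ℕ → Set (ℝ × E³) := fun n =>
    parabolicCylinder (2 * Real.sqrt 2 * s / 2 ^ n / 2)
      ((-((2 * Real.sqrt 2 * s / 2 ^ n) ^ 2 / 4) : ℝ), (0 : E³))
  set CA : ℕ → Set (ℝ × E³) := fun k =>
    parabolicCylinder (Real.sqrt 2 * s / 2 / 2 ^ k / 2)
      ((-((Real.sqrt 2 * s / 2 / 2 ^ k) ^ 2 / 4) : ℝ), b)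
  set CB : ℕ → Set (ℝ × E³) := fun k =>
    parabolicCylinder (s / 2 ^ k / 2) ((-((s / 2 ^ k) ^ 2 / 4) : ℝ), b)
  -- quanta of the mother families and of the companion families
  have hM : ENNReal.ofReal (2 * e * (2 * s) + 2 * e * (2 * Real.sqrt 2 * s)) ≤
      ∫⁻ z in (⋃ n, MA n) ∪ ⋃ n, MB n, F z :=
    quantumAccounting_twoGrid G (2 * s) (2 * Real.sqrt 2 * s) 0 he hc (by positivity)
      (by linear_combination (4 * s ^ 2) * h2sq) h0
  have hC : ENNReal.ofReal (2 * e * (Real.sqrt 2 * s / 2) + 2 * e * s) ≤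
      ∫⁻ z in (⋃ k, CA k) ∪ ⋃ k, CB k, F z :=
    quantumAccounting_twoGrid G (Real.sqrt 2 * s / 2) s b he (by positivity) hs
      (by linear_combination (-(s ^ 2 / 2)) * h2sq) hb'
  -- the mother union and the companion union are disjoint
  have hMC : Disjoint ((⋃ n, MA n) ∪ ⋃ n, MB n) ((⋃ k, CA k) ∪ ⋃ k, CB k) := by
    refine Set.disjoint_union_left.2 ⟨Set.disjoint_union_right.2 ⟨?_, ?_⟩,
      Set.disjoint_union_right.2 ⟨?_, ?_⟩⟩ <;>
      refine disjoint_iUnion_left.2 fun n => disjoint_iUnion_right.2 fun k => ?_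
    · -- `MA n` (window `2n+1`) vs `CA k` (window `2k+4`)
      exact disjoint_parabolicBand_of_sq_eq h8 (by omega) (sqMA n) (sqCA k) 0 b
    · -- `MA n` (window `2n+1`) vs `CB k` (window `2k+3`): equal windows iff `n = k + 1`
      by_cases hnk : n = k + 1
      · subst hnk
        refine disjoint_parabolicBand_of_dist ?_ _ _
        rw [dist_comm, dist_zero_right, hb]
        have h1 : s / 2 ^ k ≤ s := div_le_self hs.le (one_le_pow₀ (by norm_num))
        have h3 : 2 * s / 2 ^ (k + 1) = s / 2 ^ k := by
          rw [pow_succ]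
          field_simp
        rw [h3]
        linarith
      · exact disjoint_parabolicBand_of_sq_eq h8 (by omega) (sqMA n) (sqCB k) 0 b
    · -- `MB n` (window `2n`) vs `CA k` (window `2k+4`): equal windows iff `n = k + 2`
      by_cases hnk : n = k + 2
      · subst hnk
        refine disjoint_parabolicBand_of_dist ?_ _ _
        rw [dist_comm, dist_zero_right, hb]
        have h1 : Real.sqrt 2 * s / 2 / 2 ^ k ≤ Real.sqrt 2 * s / 2 :=
          div_le_self (by positivity) (one_le_pow₀ (by norm_num))
        have h3 : 2 * Real.sqrt 2 * s / 2 ^ (k + 2) = Real.sqrt 2 * s / 2 / 2 ^ k := by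
          rw [pow_add]
          ring
        rw [h3]
        linarith
      · exact disjoint_parabolicBand_of_sq_eq h8 (by omega) (sqMB n) (sqCA k) 0 b
    · -- `MB n` (window `2n`) vs `CB k` (window `2k+3`)
      exact disjoint_parabolicBand_of_sq_eq h8 (by omega) (sqMB n) (sqCB k) 0 b
  -- all four families lie inside `Q((0,0), 2s)`
  have hQ : ((⋃ n, MA n) ∪ ⋃ n, MB n) ∪ ((⋃ k, CA k) ∪ ⋃ k, CB k) ⊆
      parabolicCylinder (2 * s) ((0 : ℝ), (0 : E³)) := by
    refine union_subset (union_subset (iUnion_subset fun n => ?_) (iUnion_subset fun n => ?_))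
      (union_subset (iUnion_subset fun k => ?_) (iUnion_subset fun k => ?_))
    · -- `MA n`: scale `2s/2^n ≤ 2s`
      have h1 : 2 * s / 2 ^ n ≤ 2 * s := div_le_self hc.le (one_le_pow₀ (by norm_num))
      exact parabolicBand_subset_cylinder (by positivity) h1
        (by rw [norm_zero]; linarith [(by positivity : 0 < 2 * s / 2 ^ n)])
    · -- `MB n`: squared scale `8s²/4^n ≤ 2(2s)²`, radius `√2 s/2^n ≤ √2 s ≤ 2s`
      have h1 : 2 * Real.sqrt 2 * s / 2 ^ n ≤ 2 * Real.sqrt 2 * s :=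
        div_le_self (by positivity) (one_le_pow₀ (by norm_num))
      refine parabolicBand_subset_cylinder_of_sq_le ?_ ?_
      · rw [sqMB n]
        exact (div_le_self h8 (one_le_pow₀ (by norm_num))).trans_eq (by ring)
      · rw [norm_zero, zero_add]
        linarith
    · -- `CA k`: scale `√2 s/2/2^k ≤ √2 s/2 ≤ s`
      have h1 : Real.sqrt 2 * s / 2 / 2 ^ k ≤ Real.sqrt 2 * s / 2 :=
        div_le_self (by positivity) (one_le_pow₀ (by norm_num))
      exact parabolicBand_subset_cylinder (by positivity) (by linarith) (by rw [hb]; linarith)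
    · -- `CB k`: scale `s/2^k ≤ s`
      have h1 : s / 2 ^ k ≤ s := div_le_self hs.le (one_le_pow₀ (by norm_num))
      exact parabolicBand_subset_cylinder (by positivity) (by linarith) (by rw [hb]; linarith)
  have hmC : MeasurableSet ((⋃ k, CA k) ∪ ⋃ k, CB k) :=
    (MeasurableSet.iUnion fun k => (isOpen_parabolicCylinder _ _).measurableSet).union
      (MeasurableSet.iUnion fun k => (isOpen_parabolicCylinder _ _).measurableSet)
  calc ENNReal.ofReal ((3 + 5 / 2 * Real.sqrt 2) * e * (2 * s))
        = ENNReal.ofReal (2 * e * (2 * s) + 2 * e * (2 * Real.sqrt 2 * s)) +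
          ENNReal.ofReal (2 * e * (Real.sqrt 2 * s / 2) + 2 * e * s) := by
          rw [← ENNReal.ofReal_add (by positivity) (by positivity)]
          congr 1
          ring
    _ ≤ (∫⁻ z in (⋃ n, MA n) ∪ ⋃ n, MB n, F z) + ∫⁻ z in (⋃ k, CA k) ∪ ⋃ k, CB k, F z :=
          add_le_add hM hC
    _ = ∫⁻ z in ((⋃ n, MA n) ∪ ⋃ n, MB n) ∪ ((⋃ k, CA k) ∪ ⋃ k, CB k), F z :=
          (lintegral_union hmC hMC).symm
    _ ≤ ∫⁻ z in parabolicCylinder (2 * s) ((0 : ℝ), (0 : E³)), F z := lintegral_mono_set hQ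

/-- **S4♯, SHARP QUANTUM ACCOUNTING** (the card's tolerance arithmetic on the `√2`-grid, pure
measure theory over `cknE`): (a) if a gradient field pays `e ρ` in every band `Q((−ρ²/4,0),ρ/2)`,
`ρ > 0`, then `E(Q((0,0),R)) ≥ (2 + 2√2) e` for every `R > 0` (the bands of the `√2`-grid
`ρ = √2 R 2^{-m/2}`, `m ≥ 0`, tile log-time inside `Q((0,0),R)` and pay
`e R (1 + √2) Σ_k 2^{-k} = (2 + 2√2) e R`); (b) if moreover it pays `e ρ` in every band
`Q((−ρ²/4,b),ρ/2)` of a companion `‖b‖ = s > 0`, then `E(Q((0,0),2s)) ≥ (3 + 5√2/2) e` (mother grid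
from `2√2 s`: `(4 + 4√2) e s`; companion grid from `s`, disjoint from the mother's inside
`Q((0,0),2s)`: `(2 + √2) e s`; total `(6 + 5√2) e s`). [folklore] -/
theorem stub_quantumAccountingSharp :
    (∀ (G : ℝ → E³ → E³ →L[ℝ] E³) (e : ℝ), 0 ≤ e →
      (∀ ρ : ℝ, 0 < ρ → ENNReal.ofReal (e * ρ) ≤
        ∫⁻ z in parabolicCylinder (ρ / 2) ((-(ρ ^ 2 / 4) : ℝ), (0 : E³)),
          ENNReal.ofReal (frobeniusNormSq (G z.1 z.2))) →
      ∀ R : ℝ, 0 < R → ENNReal.ofReal ((2 + 2 * Real.sqrt 2) * e) ≤ cknE R ((0 : ℝ), (0 : E³)) G) ∧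
    (∀ (G : ℝ → E³ → E³ →L[ℝ] E³) (e s : ℝ) (b : E³), 0 ≤ e → 0 < s → ‖b‖ = s →
      (∀ ρ : ℝ, 0 < ρ → ENNReal.ofReal (e * ρ) ≤
        ∫⁻ z in parabolicCylinder (ρ / 2) ((-(ρ ^ 2 / 4) : ℝ), (0 : E³)),
          ENNReal.ofReal (frobeniusNormSq (G z.1 z.2))) →
      (∀ ρ : ℝ, 0 < ρ → ENNReal.ofReal (e * ρ) ≤
        ∫⁻ z in parabolicCylinder (ρ / 2) ((-(ρ ^ 2 / 4) : ℝ), b),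
          ENNReal.ofReal (frobeniusNormSq (G z.1 z.2))) →
      ENNReal.ofReal ((3 + 5 / 2 * Real.sqrt 2) * e) ≤ cknE (2 * s) ((0 : ℝ), (0 : E³)) G) :=
  ⟨quantumAccounting_mother_sharp, quantumAccounting_companion_sharp⟩

end Summit.NavierStokesRegularity.NavierStokesRegularity.Theorems.RellichScarApexLocalisation
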